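import Summits.CriticalPhenomena.PercolationContinuityZ3.Theorems.PercNearOneGluingNoHeavyLowerTailKnQuestion8CoefficientwiseNCABase
import HarnessLib

/-!
# X-elimination: an avoided vertex's edges can be summed out — NCA reduces to multi-target NO-CORE — prim-lf-2 gen 63

Support file (`--supports stmt-CriticalPhenomena-4575`, closed), prover `prim-lf-2` (gen 63).  No definitions, no named facts, no sorries; standard axioms.
Memo `prim-lf-2/CW-NCA-gen63.md` §7.  Companions: `…CoefficientwiseNCAGlue.lean` (`nca_glue`), `…CoefficientwiseNCABase.lean`.

NCA sums (NO-CORE with two-sided avoidance) of an edge set `E` rooted at `x`, for vertex sets `X, W` and monotone `f, g`: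
`NCA_E(x; X, W)[f,g] = Σ_{s ⊆ E : (∀ v ∈ X, v ∉ C_x s ∧ v ∉ C_x(E∖s)) ∧ (∀ w ∈ W, ¬(w ∈ C_x s ∧ w ∈ C_x(E∖s)))} (f(C_x s) − f(C_x(E∖s)))(g(C_x s) − g(C_x(E∖s)))`.
* `Coefficientwise.openCluster_insert_eq_of_not_mem` — if `ends e = s(c, v)` and neither `c` nor `v` lies in `C_x(t)`, then `C_x(t ∪ {e}) = C_x(t)`;
  `Coefficientwise.mem_openCluster_insert_of_mem` — if `v ∈ C_x(t)` then `c ∈ C_x(t ∪ {e})`.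
* `Coefficientwise.nca_elim_edge` — **the one-edge X-ELIMINATION IDENTITY**: if `c ∈ X` and `e ∉ E'` is an edge with ends `{c, v}`, then
  `NCA_{E' ∪ {e}}(x; X, W) = NCA_{E'}(x; X ∪ {v}, W) + NCA_{E'}(x; X, W ∪ {v})`
  (on the event `c ∉ C_x s ∪ C_x(E∖s)` the edge `e` is idle; if red it forces `v ∉ C_x s`, if blue `v ∉ C_x(E∖s)`, and `1_{v∉K} + 1_{v∉B} = 1_{v∉K∪B} + 1_{v∉K∩B}`).
* `Coefficientwise.nca_of_elim_edge` — hence NCA-positivity of `E'` for `(X ∪ {v}, W)` and `(X, W ∪ {v})` gives NCA-positivity of `E' ∪ {e}` for `(X, W)`.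
Iterating over the edges at the vertices of `X`: CONJECTURE NCA (all `X, W`) is equivalent to its `X = ∅` case, 'NO-CORE for target SETS' `Σ_{s : W ∩ C_x s ∩ C_x(E∖s) = ∅} T ≥ 0`
(memo §7); in particular the two-sided avoidance sums `(I1)_X` / the atom `A₀₀` follow from multi-target NO-CORE on smaller edge sets.
[cite: KozmaNitzan2024, Questions 8–9 (§5.5 p. 36) (context: the Question-8 pocket covariance programme)]
-/

namespace Summit.CriticalPhenomena.PercolationContinuityZ3.Theorems

open Finset Literature.Probability.Percolation

namespace Coefficientwise

variable {ι V : Type*} [DecidableEq ι]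

/-- Adding an edge `e = {c, v}` to `t` does not change the cluster of `x` when neither `c` nor `v` is in it. [cite: KozmaNitzan2024, §5.5 (context only; folklore)] -/
theorem openCluster_insert_eq_of_not_mem (ends : ι → Sym2 V) {t : Finset ι} {e : ι} {x c v : V} (he : ends e = s(c, v))
    (hc : c ∉ openCluster (ends '' (↑t : Set ι)) x) (hv : v ∉ openCluster (ends '' (↑t : Set ι)) x) :
    openCluster (ends '' (↑(insert e t) : Set ι)) x = openCluster (ends '' (↑t : Set ι)) x := by
  apply Set.Subset.antisymm
  · intro y hy
    have key := reachable_transfer (G₁ := openGraph (ends '' (↑(insert e t) : Set ι))) (G₂ := openGraph (ends '' (↑t : Set ι)))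
      (openCluster (ends '' (↑t : Set ι)) x) ?_ (Classical.choice (show (openGraph (ends '' (↑(insert e t) : Set ι))).Reachable x y from hy))
      (mem_openCluster_self _ x)
    · exact key.2
    · intro u hu w huw
      rw [openGraph_image_adj] at huw
      obtain ⟨⟨i, hi, hiuw⟩, hne⟩ := huw
      rcases Finset.mem_insert.mp hi with hie | hit
      · -- the new edge: its ends are `c, v`, neither of which is in the cluster
        exfalso
        rw [hie, he] at hiuw
        have hu' : u = c ∨ u = v := by
          have : u ∈ s(c, v) := by rw [hiuw]; exact Sym2.mem_mk_left u w
          exact Sym2.mem_iff.mp this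
        rcases hu' with h | h
        · exact hc (h ▸ hu)
        · exact hv (h ▸ hu)
      · have hadj : (openGraph (ends '' (↑t : Set ι))).Adj u w := (openGraph_image_adj ends t u w).mpr ⟨⟨i, hit, hiuw⟩, hne⟩
        refine ⟨hadj, ?_⟩
        change (openGraph (ends '' (↑t : Set ι))).Reachable x w
        exact (show (openGraph (ends '' (↑t : Set ι))).Reachable x u from hu).trans hadj.reachable
  · exact openCluster_image_mono ends (Finset.subset_insert e t) x

/-- If `v` is in the cluster of `x` for `t`, then the other end `c` of `e = {c, v}` is in the cluster for `t ∪ {e}`. [cite: KozmaNitzan2024, §5.5 (context only; folklore)] -/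
theorem mem_openCluster_insert_of_mem (ends : ι → Sym2 V) {t : Finset ι} {e : ι} {x c v : V} (he : ends e = s(c, v))
    (hv : v ∈ openCluster (ends '' (↑t : Set ι)) x) : c ∈ openCluster (ends '' (↑(insert e t) : Set ι)) x := by
  by_cases hcv : c = v
  · rw [hcv]; exact openCluster_image_mono ends (Finset.subset_insert e t) x hv
  · have hv' : v ∈ openCluster (ends '' (↑(insert e t) : Set ι)) x := openCluster_image_mono ends (Finset.subset_insert e t) x hv
    have hadj : (openGraph (ends '' (↑(insert e t) : Set ι))).Adj v c :=
      (openGraph_image_adj ends (insert e t) v c).mpr ⟨⟨e, Finset.mem_insert_self e t, by rw [he, Sym2.eq_swap]⟩, Ne.symm hcv⟩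
    change (openGraph (ends '' (↑(insert e t) : Set ι))).Reachable x c
    exact (show (openGraph (ends '' (↑(insert e t) : Set ι))).Reachable x v from hv').trans hadj.reachable

open Classical in
/-- **One-edge X-elimination identity.**  Let `e ∉ E'` be an edge with ends `{c, v}` and let `c ∈ X`.  Then
`NCA_{E'∪{e}}(x; X, W) = NCA_{E'}(x; X ∪ {v}, W) + NCA_{E'}(x; X, W ∪ {v})` for all `f, g`.  [cite: KozmaNitzan2024, Questions 8–9 (§5.5 p. 36) (context)] -/
theorem nca_elim_edge (ends : ι → Sym2 V) {E' : Finset ι} {e : ι} (he' : e ∉ E') {x c v : V} (he : ends e = s(c, v))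
    (X W : Set V) (hc : c ∈ X) (f g : Set V → ℝ) :
    ∑ s ∈ (insert e E').powerset.filter (fun s : Finset ι =>
            (∀ u ∈ X, u ∉ openCluster (ends '' (↑s : Set ι)) x ∧ u ∉ openCluster (ends '' (↑((insert e E') \ s) : Set ι)) x) ∧
            (∀ w ∈ W, ¬ (w ∈ openCluster (ends '' (↑s : Set ι)) x ∧ w ∈ openCluster (ends '' (↑((insert e E') \ s) : Set ι)) x))),
      (f (openCluster (ends '' (↑s : Set ι)) x) - f (openCluster (ends '' (↑((insert e E') \ s) : Set ι)) x)) *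
        (g (openCluster (ends '' (↑s : Set ι)) x) - g (openCluster (ends '' (↑((insert e E') \ s) : Set ι)) x))
    = ∑ s ∈ E'.powerset.filter (fun s : Finset ι =>
            (∀ u ∈ insert v X, u ∉ openCluster (ends '' (↑s : Set ι)) x ∧ u ∉ openCluster (ends '' (↑(E' \ s) : Set ι)) x) ∧
            (∀ w ∈ W, ¬ (w ∈ openCluster (ends '' (↑s : Set ι)) x ∧ w ∈ openCluster (ends '' (↑(E' \ s) : Set ι)) x))),
        (f (openCluster (ends '' (↑s : Set ι)) x) - f (openCluster (ends '' (↑(E' \ s) : Set ι)) x)) *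
          (g (openCluster (ends '' (↑s : Set ι)) x) - g (openCluster (ends '' (↑(E' \ s) : Set ι)) x))
      + ∑ s ∈ E'.powerset.filter (fun s : Finset ι =>
            (∀ u ∈ X, u ∉ openCluster (ends '' (↑s : Set ι)) x ∧ u ∉ openCluster (ends '' (↑(E' \ s) : Set ι)) x) ∧
            (∀ w ∈ insert v W, ¬ (w ∈ openCluster (ends '' (↑s : Set ι)) x ∧ w ∈ openCluster (ends '' (↑(E' \ s) : Set ι)) x))),
        (f (openCluster (ends '' (↑s : Set ι)) x) - f (openCluster (ends '' (↑(E' \ s) : Set ι)) x)) *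
          (g (openCluster (ends '' (↑s : Set ι)) x) - g (openCluster (ends '' (↑(E' \ s) : Set ι)) x)) := by
  set C : Finset ι → Set V := fun s => openCluster (ends '' (↑s : Set ι)) x with hC
  set P : Finset ι → Prop := fun s => (∀ u ∈ X, u ∉ C s ∧ u ∉ C (E' \ s)) ∧ (∀ w ∈ W, ¬ (w ∈ C s ∧ w ∈ C (E' \ s))) with hP
  set Tm : Finset ι → ℝ := fun s => (f (C s) - f (C (E' \ s))) * (g (C s) - g (C (E' \ s))) with hTm
  change ∑ s ∈ (insert e E').powerset.filter (fun s => (∀ u ∈ X, u ∉ C s ∧ u ∉ C ((insert e E') \ s)) ∧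
      (∀ w ∈ W, ¬ (w ∈ C s ∧ w ∈ C ((insert e E') \ s)))), (f (C s) - f (C ((insert e E') \ s))) * (g (C s) - g (C ((insert e E') \ s)))
    = ∑ s ∈ E'.powerset.filter (fun s => (∀ u ∈ insert v X, u ∉ C s ∧ u ∉ C (E' \ s)) ∧ (∀ w ∈ W, ¬ (w ∈ C s ∧ w ∈ C (E' \ s)))), Tm s
      + ∑ s ∈ E'.powerset.filter (fun s => (∀ u ∈ X, u ∉ C s ∧ u ∉ C (E' \ s)) ∧ (∀ w ∈ insert v W, ¬ (w ∈ C s ∧ w ∈ C (E' \ s)))), Tm s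
  -- the two right-hand events in terms of `P`
  have hX : ∀ s : Finset ι, ((∀ u ∈ insert v X, u ∉ C s ∧ u ∉ C (E' \ s)) ∧ (∀ w ∈ W, ¬ (w ∈ C s ∧ w ∈ C (E' \ s)))) ↔
      (P s ∧ (v ∉ C s ∧ v ∉ C (E' \ s))) := by
    intro s; constructor
    · rintro ⟨h1, h2⟩
      exact ⟨⟨fun u hu => h1 u (Set.mem_insert_of_mem v hu), h2⟩, h1 v (Set.mem_insert v X)⟩
    · rintro ⟨⟨h1, h2⟩, h3⟩
      exact ⟨fun u hu => (Set.mem_insert_iff.mp hu).elim (fun h => h ▸ h3) (fun h => h1 u h), h2⟩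
  have hW : ∀ s : Finset ι, ((∀ u ∈ X, u ∉ C s ∧ u ∉ C (E' \ s)) ∧ (∀ w ∈ insert v W, ¬ (w ∈ C s ∧ w ∈ C (E' \ s)))) ↔
      (P s ∧ ¬ (v ∈ C s ∧ v ∈ C (E' \ s))) := by
    intro s; constructor
    · rintro ⟨h1, h2⟩
      exact ⟨⟨h1, fun w hw => h2 w (Set.mem_insert_of_mem v hw)⟩, h2 v (Set.mem_insert v W)⟩
    · rintro ⟨⟨h1, h2⟩, h3⟩
      exact ⟨h1, fun w hw => (Set.mem_insert_iff.mp hw).elim (fun h => h ▸ h3) (fun h => h2 w h)⟩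
  rw [Finset.sum_filter, Finset.sum_filter, Finset.sum_filter, Finset.sum_powerset_insert he', ← Finset.sum_add_distrib,
    ← Finset.sum_add_distrib]
  refine Finset.sum_congr rfl fun s hs => ?_
  have hsE : s ⊆ E' := Finset.mem_powerset.mp hs
  have hes : e ∉ s := fun h => he' (hsE h)
  -- complements inside `insert e E'`
  have hc1 : (insert e E') \ s = insert e (E' \ s) := Finset.insert_sdiff_of_notMem E' hes
  have hc2 : (insert e E') \ (insert e s) = E' \ s := by
    rw [Finset.insert_sdiff_insert, Finset.sdiff_insert_of_notMem he']
  rw [hc1, hc2, if_congr (hX s) rfl rfl, if_congr (hW s) rfl rfl]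
  by_cases hp : P s
  · have hcK : c ∉ C s := (hp.1 c hc).1
    have hcB : c ∉ C (E' \ s) := (hp.1 c hc).2
    by_cases hvK : v ∈ C s <;> by_cases hvB : v ∈ C (E' \ s)
    · -- `v` in both: every event fails
      have c1 : ¬ ((∀ u ∈ X, u ∉ C s ∧ u ∉ C (insert e (E' \ s))) ∧ (∀ w ∈ W, ¬ (w ∈ C s ∧ w ∈ C (insert e (E' \ s))))) :=
        fun h => (h.1 c hc).2 (mem_openCluster_insert_of_mem ends he hvB)
      have c2 : ¬ ((∀ u ∈ X, u ∉ C (insert e s) ∧ u ∉ C (E' \ s)) ∧ (∀ w ∈ W, ¬ (w ∈ C (insert e s) ∧ w ∈ C (E' \ s)))) :=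
        fun h => (h.1 c hc).1 (mem_openCluster_insert_of_mem ends he hvK)
      have c3 : ¬ (P s ∧ (v ∉ C s ∧ v ∉ C (E' \ s))) := fun h => h.2.1 hvK
      have c4 : ¬ (P s ∧ ¬ (v ∈ C s ∧ v ∈ C (E' \ s))) := fun h => h.2 ⟨hvK, hvB⟩
      rw [if_neg c1, if_neg c2, if_neg c3, if_neg c4]
    · -- `v ∈ C s` only: red `e` kills the event, blue `e` is idle
      have hB : C (insert e (E' \ s)) = C (E' \ s) := openCluster_insert_eq_of_not_mem ends he hcB hvB
      have c1 : ((∀ u ∈ X, u ∉ C s ∧ u ∉ C (insert e (E' \ s))) ∧ (∀ w ∈ W, ¬ (w ∈ C s ∧ w ∈ C (insert e (E' \ s))))) := by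
        rw [hB]; exact hp
      have c2 : ¬ ((∀ u ∈ X, u ∉ C (insert e s) ∧ u ∉ C (E' \ s)) ∧ (∀ w ∈ W, ¬ (w ∈ C (insert e s) ∧ w ∈ C (E' \ s)))) :=
        fun h => (h.1 c hc).1 (mem_openCluster_insert_of_mem ends he hvK)
      have c3 : ¬ (P s ∧ (v ∉ C s ∧ v ∉ C (E' \ s))) := fun h => h.2.1 hvK
      have c4 : (P s ∧ ¬ (v ∈ C s ∧ v ∈ C (E' \ s))) := ⟨hp, fun h => hvB h.2⟩
      rw [if_pos c1, if_neg c2, if_neg c3, if_pos c4, hB]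
      simp only [hTm]; ring
    · -- `v ∈ C (E' ∖ s)` only: red `e` is idle, blue `e` kills the event
      have hK : C (insert e s) = C s := openCluster_insert_eq_of_not_mem ends he hcK hvK
      have c1 : ¬ ((∀ u ∈ X, u ∉ C s ∧ u ∉ C (insert e (E' \ s))) ∧ (∀ w ∈ W, ¬ (w ∈ C s ∧ w ∈ C (insert e (E' \ s))))) :=
        fun h => (h.1 c hc).2 (mem_openCluster_insert_of_mem ends he hvB)
      have c2 : ((∀ u ∈ X, u ∉ C (insert e s) ∧ u ∉ C (E' \ s)) ∧ (∀ w ∈ W, ¬ (w ∈ C (insert e s) ∧ w ∈ C (E' \ s)))) := by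
        rw [hK]; exact hp
      have c3 : ¬ (P s ∧ (v ∉ C s ∧ v ∉ C (E' \ s))) := fun h => h.2.2 hvB
      have c4 : (P s ∧ ¬ (v ∈ C s ∧ v ∈ C (E' \ s))) := ⟨hp, fun h => hvK h.1⟩
      rw [if_neg c1, if_pos c2, if_neg c3, if_pos c4, hK]
    · -- `v` in neither: both colours of `e` are idle
      have hB : C (insert e (E' \ s)) = C (E' \ s) := openCluster_insert_eq_of_not_mem ends he hcB hvB
      have hK : C (insert e s) = C s := openCluster_insert_eq_of_not_mem ends he hcK hvK
      have c1 : ((∀ u ∈ X, u ∉ C s ∧ u ∉ C (insert e (E' \ s))) ∧ (∀ w ∈ W, ¬ (w ∈ C s ∧ w ∈ C (insert e (E' \ s))))) := by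
        rw [hB]; exact hp
      have c2 : ((∀ u ∈ X, u ∉ C (insert e s) ∧ u ∉ C (E' \ s)) ∧ (∀ w ∈ W, ¬ (w ∈ C (insert e s) ∧ w ∈ C (E' \ s)))) := by
        rw [hK]; exact hp
      have c3 : (P s ∧ (v ∉ C s ∧ v ∉ C (E' \ s))) := ⟨hp, hvK, hvB⟩
      have c4 : (P s ∧ ¬ (v ∈ C s ∧ v ∈ C (E' \ s))) := ⟨hp, fun h => hvK h.1⟩
      rw [if_pos c1, if_pos c2, if_pos c3, if_pos c4, hB, hK]
  · -- the `E'`-event fails: every event fails (the left events imply `P s` by monotonicity of clusters)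
    have hmono1 : C s ⊆ C (insert e s) := openCluster_image_mono ends (Finset.subset_insert e s) x
    have hmono2 : C (E' \ s) ⊆ C (insert e (E' \ s)) := openCluster_image_mono ends (Finset.subset_insert e _) x
    have c1 : ¬ ((∀ u ∈ X, u ∉ C s ∧ u ∉ C (insert e (E' \ s))) ∧ (∀ w ∈ W, ¬ (w ∈ C s ∧ w ∈ C (insert e (E' \ s))))) :=
      fun h => hp ⟨fun u hu => ⟨(h.1 u hu).1, fun h' => (h.1 u hu).2 (hmono2 h')⟩, fun w hw h' => h.2 w hw ⟨h'.1, hmono2 h'.2⟩⟩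
    have c2 : ¬ ((∀ u ∈ X, u ∉ C (insert e s) ∧ u ∉ C (E' \ s)) ∧ (∀ w ∈ W, ¬ (w ∈ C (insert e s) ∧ w ∈ C (E' \ s)))) :=
      fun h => hp ⟨fun u hu => ⟨fun h' => (h.1 u hu).1 (hmono1 h'), (h.1 u hu).2⟩, fun w hw h' => h.2 w hw ⟨hmono1 h'.1, h'.2⟩⟩
    have c3 : ¬ (P s ∧ (v ∉ C s ∧ v ∉ C (E' \ s))) := fun h => hp h.1
    have c4 : ¬ (P s ∧ ¬ (v ∈ C s ∧ v ∈ C (E' \ s))) := fun h => hp h.1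
    rw [if_neg c1, if_neg c2, if_neg c3, if_neg c4]

open Classical in
/-- **NCA-positivity passes from `E'` to `E' ∪ {e}` along an edge at an avoided vertex.**  If `c ∈ X`, `e ∉ E'` has ends `{c, v}`, and the NCA sums of `(E', x)` for
`(X ∪ {v}, W)` and for `(X, W ∪ {v})` are nonnegative (for the given `f, g`), then so is the NCA sum of `(E' ∪ {e}, x)` for `(X, W)`.
[cite: KozmaNitzan2024, Questions 8–9 (§5.5 p. 36) (context)] -/
theorem nca_of_elim_edge (ends : ι → Sym2 V) {E' : Finset ι} {e : ι} (he' : e ∉ E') {x c v : V} (he : ends e = s(c, v))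
    (X W : Set V) (hc : c ∈ X) (f g : Set V → ℝ)
    (h₁ : 0 ≤ ∑ s ∈ E'.powerset.filter (fun s : Finset ι =>
            (∀ u ∈ insert v X, u ∉ openCluster (ends '' (↑s : Set ι)) x ∧ u ∉ openCluster (ends '' (↑(E' \ s) : Set ι)) x) ∧
            (∀ w ∈ W, ¬ (w ∈ openCluster (ends '' (↑s : Set ι)) x ∧ w ∈ openCluster (ends '' (↑(E' \ s) : Set ι)) x))),
        (f (openCluster (ends '' (↑s : Set ι)) x) - f (openCluster (ends '' (↑(E' \ s) : Set ι)) x)) *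
          (g (openCluster (ends '' (↑s : Set ι)) x) - g (openCluster (ends '' (↑(E' \ s) : Set ι)) x)))
    (h₂ : 0 ≤ ∑ s ∈ E'.powerset.filter (fun s : Finset ι =>
            (∀ u ∈ X, u ∉ openCluster (ends '' (↑s : Set ι)) x ∧ u ∉ openCluster (ends '' (↑(E' \ s) : Set ι)) x) ∧
            (∀ w ∈ insert v W, ¬ (w ∈ openCluster (ends '' (↑s : Set ι)) x ∧ w ∈ openCluster (ends '' (↑(E' \ s) : Set ι)) x))),
        (f (openCluster (ends '' (↑s : Set ι)) x) - f (openCluster (ends '' (↑(E' \ s) : Set ι)) x)) *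
          (g (openCluster (ends '' (↑s : Set ι)) x) - g (openCluster (ends '' (↑(E' \ s) : Set ι)) x))) :
    0 ≤ ∑ s ∈ (insert e E').powerset.filter (fun s : Finset ι =>
            (∀ u ∈ X, u ∉ openCluster (ends '' (↑s : Set ι)) x ∧ u ∉ openCluster (ends '' (↑((insert e E') \ s) : Set ι)) x) ∧
            (∀ w ∈ W, ¬ (w ∈ openCluster (ends '' (↑s : Set ι)) x ∧ w ∈ openCluster (ends '' (↑((insert e E') \ s) : Set ι)) x))),
      (f (openCluster (ends '' (↑s : Set ι)) x) - f (openCluster (ends '' (↑((insert e E') \ s) : Set ι)) x)) *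
        (g (openCluster (ends '' (↑s : Set ι)) x) - g (openCluster (ends '' (↑((insert e E') \ s) : Set ι)) x)) := by
  rw [nca_elim_edge ends he' he X W hc f g]
  exact add_nonneg h₁ h₂

end Coefficientwise

end Summit.CriticalPhenomena.PercolationContinuityZ3.Theorems
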